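import Literature.Probability.RandomPlanarGeometry.RestrictionDerivOuter
import Literature.Probability.RandomPlanarGeometry.StarHullCanonical
import Literature.Probability.RandomPlanarGeometry.HalfPlaneFillProofs
import HarnessLib

/-!
# `Φ'_B(0)` as a countable supremum over rational thickened hulls (measurability of `B ↦ Φ'_B(0)`)

G. F. Lawler, O. Schramm, W. Werner, *Conformal restriction: the chordal case*, J. Amer. Math.
Soc. **16** (2003) 917–955, arXiv:math/0209343 (**[LSW]**), §2 (2.4) and §5.

In [LSW] §5 the process `Y_t = h_t'(W_t)^{5/8} = Φ'_{A_t − W_t}(0)^{5/8}` is a functional of the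
random `*`-hull `B_t = A_t − W_t`, and its adaptedness to the Brownian filtration is implicit. To
prove it in the tree we express the restriction derivative `d_B = Φ'_B(0)` (`starDeriv B`,
`StarHullCanonical`) of an ARBITRARY nonempty `*`-hull `B` as a supremum over a fixed COUNTABLE
family of hulls:

* `Literature.Probability.RandomPlanarGeometry.ratHull i` — for `i = (P, r)`, `P` a finite set of
  rational points and `r` a rational radius, the thickened hull `thickHull (points of P) r`
  (`HullThickening`: the half-plane fill of the closed `r`-neighbourhood in `ℍ̄`);
* `Literature.Probability.RandomPlanarGeometry.exists_ratHull_between` — PROVED: every nonempty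
  `*`-hull `B` is squeezed, for every `δ > 0`, as `B ⊆ ratHull i ⊆ thickHull B δ` with
  `ratHull i ∈ 𝒬*` (a finite rational net of `B`; the fill of an attached bounded closed set off
  `0` is a `*`-hull, `isStarHull_hpFill` with Conway's criterion
  `isSimplyConnected_of_isConnected_compl_holds`);
* `Literature.Probability.RandomPlanarGeometry.starDeriv_eq_iSup_ratTerm` — PROVED:
  `Φ'_B(0) = sup_i [Φ'_{ratHull i}(0) if ratHull i ∈ 𝒬* and B ⊆ ratHull i, else 0]`, by the
  antitonicity `B ⊆ H ⇒ Φ'_H(0) ≤ Φ'_B(0)` ([LSW] (2.4) with the semigroup `H = B · B'`, the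
  tree's `HasRestrictionDeriv.le_of_subset`) and the outer continuity of `Φ'_·(0)` along
  thickened hulls (`HasRestrictionDeriv.exists_forall_outer_ge`, `RestrictionDerivOuter`);
* `Literature.Probability.RandomPlanarGeometry.measurable_iSup_ratTerm` — PROVED: consequently
  `ω ↦ sup_i ratTerm (B ω) i` is measurable as soon as the events `{B ω ⊆ ratHull i}` are.

## References

* [LSW] §2 (2.4) p. 7 ("`0 < g_A'(x) ≤ 1`"; monotonicity in `A`), §2 p. 8 (Fillings), §5
  (`h_t'(W_t)`). [LawlerSchrammWerner2003Restriction]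
-/

noncomputable section

open Set Filter Topology Metric Bornology Complex
open UpperHalfPlane (upperHalfPlaneSet isOpen_upperHalfPlaneSet)
open scoped NNReal

namespace Literature.Probability.RandomPlanarGeometry

/-! ### Rational thickened hulls -/

/-- The point of `ℂ` with rational coordinates `p = (x, y)`. [folklore] -/
def ratPt (p : ℚ × ℚ) : ℂ := ⟨p.1, p.2⟩

/-- The rational points are dense: every `z` is within any `ε > 0` of some `ratPt p`.
[folklore] -/
theorem exists_ratPt_dist_lt (z : ℂ) {ε : ℝ} (hε : 0 < ε) : ∃ p : ℚ × ℚ, dist z (ratPt p) < ε := by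
  obtain ⟨x, hx1, hx2⟩ := exists_rat_btwn (show z.re - ε / 2 < z.re + ε / 2 by linarith)
  obtain ⟨y, hy1, hy2⟩ := exists_rat_btwn (show z.im - ε / 2 < z.im + ε / 2 by linarith)
  refine ⟨(x, y), ?_⟩
  have hre : (z - ratPt (x, y)).re = z.re - x := rfl
  have him : (z - ratPt (x, y)).im = z.im - y := rfl
  have h1 : |(z - ratPt (x, y)).re| < ε / 2 := by
    rw [hre]; exact abs_sub_lt_iff.2 ⟨by linarith, by linarith⟩
  have h2 : |(z - ratPt (x, y)).im| < ε / 2 := by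
    rw [him]; exact abs_sub_lt_iff.2 ⟨by linarith, by linarith⟩
  rw [dist_eq_norm]
  calc ‖z - ratPt (x, y)‖ ≤ |(z - ratPt (x, y)).re| + |(z - ratPt (x, y)).im| :=
        Complex.norm_le_abs_re_add_abs_im _
    _ < ε / 2 + ε / 2 := add_lt_add h1 h2
    _ = ε := by ring

/-- **The rational thickened hull** indexed by `i = (P, r)`: the half-plane fill of the closed
`r`-neighbourhood (within `ℍ̄`) of the finite set of rational points `P`
(`thickHull (ratPt '' P) r`). A countable family of closed sets.
[cite: LawlerSchrammWerner2003Restriction, §2 p. 8 (Fillings)] -/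
def ratHull (i : Finset (ℚ × ℚ) × ℚ) : Set ℂ := thickHull (ratPt '' (i.1 : Set (ℚ × ℚ))) (i.2 : ℝ)

/-- Rational thickened hulls are closed. [folklore] -/
theorem isClosed_ratHull (i : Finset (ℚ × ℚ) × ℚ) : IsClosed (ratHull i) := isClosed_thickHull _ _

/-! ### Squeezing a `*`-hull between itself and a thickening, by a rational hull -/

section Squeeze

variable {B : Set ℂ}

/-- A finite union of connected sets, each meeting a fixed connected set `C`, is connected
together with `C`. [folklore] -/
theorem isConnected_union_biUnion_finset {ι : Type*} (s : Finset ι) {C : Set ℂ} (hC : IsConnected C)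
    {K : ι → Set ℂ} (hK : ∀ i ∈ s, IsConnected (K i)) (hmeet : ∀ i ∈ s, (K i ∩ C).Nonempty) :
    IsConnected (C ∪ ⋃ i ∈ s, K i) := by
  classical
  induction s using Finset.induction_on with
  | empty => simpa using hC
  | insert a s ha ih =>
    have h1 : IsConnected (C ∪ ⋃ i ∈ s, K i) :=
      ih (fun i hi ↦ hK i (Finset.mem_insert_of_mem hi)) (fun i hi ↦ hmeet i (Finset.mem_insert_of_mem hi))
    obtain ⟨x, hxK, hxC⟩ := hmeet a (Finset.mem_insert_self a s)
    have h2 : IsConnected ((C ∪ ⋃ i ∈ s, K i) ∪ K a) :=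
      IsConnected.union ⟨x, Or.inl hxC, hxK⟩ h1 (hK a (Finset.mem_insert_self a s))
    convert h2 using 1
    ext z
    simp only [Finset.set_biUnion_insert, mem_union, mem_iUnion]
    constructor
    · rintro (h | h | ⟨i, hi, h⟩)
      exacts [Or.inl (Or.inl h), Or.inr h, Or.inl (Or.inr ⟨i, hi, h⟩)]
    · rintro ((h | ⟨i, hi, h⟩) | h)
      exacts [Or.inl h, Or.inr (Or.inr ⟨i, hi, h⟩), Or.inr (Or.inl h)]

/-- Points of a `*`-hull have non-negative imaginary part. [folklore] -/
theorem IsStarHull.im_nonneg (hB : IsStarHull B) {b : ℂ} (hb : b ∈ B) : 0 ≤ b.im := by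
  have := hB.isBoundedHull.subset_closure hb
  rwa [Complex.closure_setOf_lt_im] at this

/-- **Every `*`-hull is squeezed by rational hulls**: for `B ∈ 𝒬*` and `δ > 0` there is a rational thickened hull `H = ratHull i ∈ 𝒬*` with `B ⊆ H ⊆ thickHull B δ` (take a
finite rational `2r`-net `P` of `B` by points within `r` of `B`, `3r ≤ δ` and `3r` below the scale
at which thickenings of `B` reach `0`; `H` is the fill of the attached bounded closed set
`⋃_{p ∈ P} B̄(p, 2r) ∩ ℍ̄`, a `*`-hull by `isStarHull_hpFill`).
[cite: LawlerSchrammWerner2003Restriction, §2 p. 8 (Fillings, *-hulls)] -/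
theorem exists_ratHull_between (hB : IsStarHull B) {δ : ℝ} (hδ : 0 < δ) :
    ∃ i : Finset (ℚ × ℚ) × ℚ, IsStarHull (ratHull i) ∧ B ⊆ ratHull i ∧ ratHull i ⊆ thickHull B δ := by
  classical
  have hBc : IsCompact B := hB.isBoundedHull.isCompact
  -- the scale `s₀` below which thickenings of `B` miss `0`
  obtain ⟨s₀, hs₀, hs₀F⟩ := exists_forall_zero_notMem_thickHull hB
  -- a rational radius `r` with `4 r < min δ (s₀ / 2)`
  obtain ⟨r, hr0, hr⟩ : ∃ r : ℚ, (0 : ℝ) < r ∧ 4 * (r : ℝ) < min δ (s₀ / 2) := by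
    obtain ⟨r, hr0, hr⟩ := exists_rat_btwn (show (0 : ℝ) < min δ (s₀ / 2) / 4 by positivity)
    exact ⟨r, by exact_mod_cast hr0, by linarith⟩
  have hrδ : (r : ℝ) + r + r ≤ δ := by linarith [min_le_left δ (s₀ / 2)]
  have hrs : (r : ℝ) + r + r < s₀ := by linarith [min_le_right δ (s₀ / 2)]
  -- a finite `r`-net of `B` by points of `B`, then rational points within `r` of those
  obtain ⟨t, htB, htfin, hcover⟩ := hBc.finite_cover_balls hr0
  choose f hf using fun b : ℂ ↦ exists_ratPt_dist_lt b hr0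
  set P : Finset (ℚ × ℚ) := htfin.toFinset.image f with hP
  set Pts : Set ℂ := ratPt '' (P : Set (ℚ × ℚ)) with hPts
  have hPfin : Pts.Finite := P.finite_toSet.image _
  -- each rational point is within `r` of `B`; each point of `B` is within `2r` of `Pts`
  have hPnear : ∀ p ∈ P, ∃ b ∈ B, dist b (ratPt p) < r := by
    intro p hp
    rw [hP, Finset.mem_image] at hp
    obtain ⟨b, hb, rfl⟩ := hp
    exact ⟨b, htB (htfin.mem_toFinset.1 hb), hf b⟩
  have hPtsnear : ∀ q ∈ Pts, ∃ b ∈ B, dist b q < r := by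
    rintro _ ⟨p, hp, rfl⟩
    exact hPnear p hp
  have hBnear : ∀ b ∈ B, ∃ q ∈ Pts, dist b q ≤ (r : ℝ) + r := by
    intro b hb
    obtain ⟨x, hx, hbx⟩ := mem_iUnion₂.1 (hcover hb)
    refine ⟨ratPt (f x), ⟨f x, ?_, rfl⟩, ?_⟩
    · rw [hP, Finset.coe_image]
      exact ⟨x, htfin.mem_toFinset.2 hx, rfl⟩
    · have h1 : dist b x < r := mem_ball.1 hbx
      linarith [dist_triangle b x (ratPt (f x)), hf x]
  -- the attached neighbourhood `S` and the identification `ratHull (P, 2r) = hpFill S`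
  set S : Set ℂ := nbhdSet Pts ((r : ℝ) + r) with hS
  have hSdef : ratHull (P, r + r) = hpFill S := by
    simp only [ratHull, thickHull, hS, hPts]
    push_cast
    rfl
  have hrr0 : (0 : ℝ) ≤ (r : ℝ) + r := by positivity
  have hBS : B ⊆ S := fun b hb ↦
    (mem_nbhdSet_iff hPfin.isCompact hrr0).2 ⟨hBnear b hb, hB.im_nonneg hb⟩
  have hSsub : S ⊆ nbhdSet B ((r : ℝ) + r + r) := by
    intro z hz
    obtain ⟨⟨q, hq, hzq⟩, hzim⟩ := (mem_nbhdSet_iff hPfin.isCompact hrr0).1 hz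
    obtain ⟨b, hb, hbq⟩ := hPtsnear q hq
    refine (mem_nbhdSet_iff hBc (by positivity)).2 ⟨⟨b, hb, ?_⟩, hzim⟩
    linarith [dist_triangle z q b, dist_comm b q]
  have hfill_sub : hpFill S ⊆ thickHull B δ :=
    (hpFill_mono hSsub).trans (thickHull_mono B hrδ)
  have h0 : (0 : ℂ) ∉ hpFill S := fun h ↦
    hs₀F ((r : ℝ) + r + r) (by positivity) hrs ((hpFill_mono hSsub) h)
  -- connectedness of `S ∪ {im ≤ 0}`
  have hconn : IsConnected (S ∪ {z : ℂ | z.im ≤ 0}) := by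
    have hC := hB.isBoundedHull.isConnected_union_im_nonpos
    set K : ℚ × ℚ → Set ℂ := fun p ↦ closedBall (ratPt p) ((r : ℝ) + r) ∩ {z : ℂ | 0 ≤ z.im} with hK
    have hKc : ∀ p ∈ P, IsConnected (K p) := by
      intro p hp
      obtain ⟨b, hb, hbd⟩ := hPnear p hp
      refine ⟨⟨b, mem_closedBall.2 (by linarith [hbd.le]), hB.im_nonneg hb⟩, ?_⟩
      exact ((convex_closedBall _ _).inter (convex_halfSpace_im_ge 0)).isPreconnected
    have hmeet : ∀ p ∈ P, (K p ∩ (B ∪ {z : ℂ | z.im ≤ 0})).Nonempty := by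
      intro p hp
      obtain ⟨b, hb, hbd⟩ := hPnear p hp
      exact ⟨b, ⟨mem_closedBall.2 (by linarith [hbd.le]), hB.im_nonneg hb⟩, Or.inl hb⟩
    have h := isConnected_union_biUnion_finset P hC hKc hmeet
    have hSK : S = ⋃ p ∈ P, K p := by
      ext z
      rw [hS, mem_nbhdSet_iff hPfin.isCompact hrr0, mem_iUnion₂]
      simp only [hK, mem_inter_iff, mem_closedBall, mem_setOf_eq, hPts, mem_image, Finset.mem_coe,
        exists_prop]
      constructor
      · rintro ⟨⟨_, ⟨p, hp, rfl⟩, hd⟩, him⟩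
        exact ⟨p, hp, hd, him⟩
      · rintro ⟨p, hp, hd, him⟩
        exact ⟨⟨ratPt p, ⟨p, hp, rfl⟩, hd⟩, him⟩
    have heq : S ∪ {z : ℂ | z.im ≤ 0} = (B ∪ {z : ℂ | z.im ≤ 0}) ∪ ⋃ p ∈ P, K p := by
      rw [← hSK]
      ext z
      simp only [mem_union]
      constructor
      · rintro (h | h)
        exacts [Or.inr h, Or.inl (Or.inr h)]
      · rintro ((h | h) | h)
        exacts [Or.inl (hBS h), Or.inr h, Or.inl h]
    rw [heq]
    exact h
  have hstar : IsStarHull (hpFill S) :=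
    isStarHull_hpFill isSimplyConnected_of_isConnected_compl_holds (isClosed_nbhdSet _ _)
      (isBounded_nbhdSet hPfin.isBounded _) hconn h0
  have hBfill : B ⊆ hpFill S := by
    have h1 : B ∩ upperHalfPlaneSet ⊆ hpFill S :=
      (inter_subset_inter_left _ hBS).trans (inter_subset_hpFill S)
    calc B = closure (B ∩ upperHalfPlaneSet) := hB.1.2.1.symm
      _ ⊆ hpFill S := closure_minimal h1 (isClosed_hpFill S)
  refine ⟨(P, r + r), ?_, ?_, ?_⟩
  · rw [hSdef]; exact hstar
  · rw [hSdef]; exact hBfill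
  · rw [hSdef]; exact hfill_sub

end Squeeze

/-! ### The countable supremum formula for `Φ'_B(0)` -/

section Sup

variable {B : Set ℂ}

open Classical in
/-- The `i`-th term of the supremum: `Φ'_{ratHull i}(0)` if `ratHull i` is a `*`-hull containing
`B`, and `0` otherwise. [folklore] -/
def ratTerm (B : Set ℂ) (i : Finset (ℚ × ℚ) × ℚ) : ℝ :=
  if IsStarHull (ratHull i) ∧ B ⊆ ratHull i then starDeriv (ratHull i) else 0

/-- `0 ≤ ratTerm B i ≤ 1`. [folklore] -/
theorem ratTerm_mem_Icc (B : Set ℂ) (i : Finset (ℚ × ℚ) × ℚ) : ratTerm B i ∈ Icc (0 : ℝ) 1 := by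
  rw [ratTerm]
  split_ifs with h
  · obtain ⟨h0, h1, -⟩ := starDeriv_spec h.1
    exact ⟨h0.le, h1⟩
  · exact ⟨le_rfl, zero_le_one⟩

/-- The terms are bounded above (by `1`). [folklore] -/
theorem bddAbove_range_ratTerm (B : Set ℂ) : BddAbove (range (ratTerm B)) :=
  ⟨1, by rintro _ ⟨i, rfl⟩; exact (ratTerm_mem_Icc B i).2⟩

/-- **Antitonicity**: each term is `≤ Φ'_B(0)` (`B ⊆ H`, both `*`-hulls, gives
`Φ'_H(0) ≤ Φ'_B(0)`, [LSW] (2.4) in the form `HasRestrictionDeriv.le_of_subset`).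
[cite: LawlerSchrammWerner2003Restriction, §2 (2.4)] -/
theorem ratTerm_le_starDeriv (hB : IsStarHull B) (i : Finset (ℚ × ℚ) × ℚ) : ratTerm B i ≤ starDeriv B := by
  rw [ratTerm]
  split_ifs with h
  · exact HasRestrictionDeriv.le_of_subset h.1 hB h.2 (isRestrictionMap_starRMap h.1)
      (isRestrictionMap_starRMap hB) (starDeriv_spec h.1).2.2 (starDeriv_spec hB).2.2
  · exact (starDeriv_spec hB).1.le

/-- **`Φ'_B(0)` is the countable supremum of the terms** for every nonempty `*`-hull `B`:
`≥` by antitonicity, `≤` by outer continuity (`HasRestrictionDeriv.exists_forall_outer_ge`) at a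
rational hull squeezed between `B` and a thin thickening (`exists_ratHull_between`).
[cite: LawlerSchrammWerner2003Restriction, §2 (2.4)] -/
theorem starDeriv_eq_iSup_ratTerm (hB : IsStarHull B) (hne : B.Nonempty) :
    starDeriv B = ⨆ i, ratTerm B i := by
  refine le_antisymm ?_ (ciSup_le (ratTerm_le_starDeriv hB))
  obtain ⟨hd0, -, hd⟩ := starDeriv_spec hB
  have key : ∀ ε : ℝ, 0 < ε → (1 - ε) * starDeriv B ≤ ⨆ i, ratTerm B i := by
    intro ε hε
    obtain ⟨δ, hδ, hout⟩ := hd.exists_forall_outer_ge hB hne (isRestrictionMap_starRMap hB) hε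
    obtain ⟨i, hi, hBi, hiδ⟩ := exists_ratHull_between hB hδ
    have h1 := hout hi hBi hiδ (isRestrictionMap_starRMap hi) (starDeriv_spec hi).2.2
    have h2 : ratTerm B i = starDeriv (ratHull i) := by
      rw [ratTerm, if_pos ⟨hi, hBi⟩]
    calc (1 - ε) * starDeriv B ≤ starDeriv (ratHull i) := h1
      _ = ratTerm B i := h2.symm
      _ ≤ ⨆ i, ratTerm B i := le_ciSup (bddAbove_range_ratTerm B) i
  have hlim : Tendsto (fun ε : ℝ ↦ (1 - ε) * starDeriv B) (𝓝[>] 0) (𝓝 ((1 - 0) * starDeriv B)) :=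
    ((tendsto_const_nhds.sub tendsto_id).mul tendsto_const_nhds).mono_left nhdsWithin_le_nhds
  rw [sub_zero, one_mul] at hlim
  exact le_of_tendsto hlim (eventually_nhdsWithin_of_forall fun ε hε ↦ key ε hε)

/-- The supremum lies in `[0, 1]` (for any set `B`). [folklore] -/
theorem iSup_ratTerm_mem_Icc (B : Set ℂ) : (⨆ i, ratTerm B i) ∈ Icc (0 : ℝ) 1 :=
  ⟨(ratTerm_mem_Icc B (∅, 0)).1.trans (le_ciSup (bddAbove_range_ratTerm B) _),
    ciSup_le fun i ↦ (ratTerm_mem_Icc B i).2⟩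

end Sup

/-! ### Measurability of `ω ↦ Φ'_{B(ω)}(0)` through the supremum formula -/

section Meas

variable {Ω : Type*} [MeasurableSpace Ω] {Bω : Ω → Set ℂ}

/-- **Measurability of the supremum**: if the events `{B ω ⊆ ratHull i}` are measurable, then so
is `ω ↦ sup_i ratTerm (B ω) i` (a countable supremum of two-valued measurable functions); by
`starDeriv_eq_iSup_ratTerm` this is `ω ↦ Φ'_{B ω}(0)` wherever `B ω` is a nonempty `*`-hull.
[folklore] -/
theorem measurable_iSup_ratTerm (hmeas : ∀ i, MeasurableSet {ω | Bω ω ⊆ ratHull i}) :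
    Measurable fun ω ↦ ⨆ i, ratTerm (Bω ω) i := by
  classical
  refine Measurable.iSup fun i ↦ ?_
  by_cases hi : IsStarHull (ratHull i)
  · have : (fun ω ↦ ratTerm (Bω ω) i) =
        fun ω ↦ if ω ∈ {ω | Bω ω ⊆ ratHull i} then starDeriv (ratHull i) else 0 := by
      ext ω
      simp only [ratTerm, mem_setOf_eq]
      by_cases h : Bω ω ⊆ ratHull i
      · rw [if_pos ⟨hi, h⟩, if_pos h]
      · rw [if_neg (fun h' ↦ h h'.2), if_neg h]
    rw [this]
    exact Measurable.ite (hmeas i) measurable_const measurable_const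
  · have : (fun ω ↦ ratTerm (Bω ω) i) = fun _ ↦ 0 := by
      ext ω
      rw [ratTerm, if_neg (fun h' ↦ hi h'.1)]
    rw [this]
    exact measurable_const

/-- For closed `H`, the event `{B ω ⊆ H}` is measurable as soon as `B ω` is the closure of a
countable family of measurable points `w n ω`: `B ω ⊆ H ↔ ∀ n, w n ω ∈ H`. [folklore] -/
theorem measurableSet_subset_of_closure_range {H : Set ℂ} (hH : IsClosed H) {w : ℕ → Ω → ℂ}
    (hw : ∀ n, Measurable (w n)) (hBw : ∀ ω, Bω ω = closure (range fun n ↦ w n ω)) :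
    MeasurableSet {ω | Bω ω ⊆ H} := by
  have : {ω | Bω ω ⊆ H} = ⋂ n, (w n) ⁻¹' H := by
    ext ω
    simp only [mem_setOf_eq, mem_iInter, mem_preimage]
    rw [hBw ω]
    constructor
    · exact fun h n ↦ h (subset_closure (mem_range_self n))
    · exact fun h ↦ closure_minimal (range_subset_iff.2 h) hH
  rw [this]
  exact MeasurableSet.iInter fun n ↦ hw n hH.measurableSet

end Meas

end Literature.Probability.RandomPlanarGeometry

end
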